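import Summits.MatrixMultiplication.MatrixMultiplication.Theorems.GraphEquationsFibreJet

/-!
# GraphEquations — the jet count (THEOREM ED (a), part 2/4)

Decomp-mm node «GraphEquations» (lens 5); attacked crux `MultiplicityReduction` (route
GraphEquations, item stmt-MatrixMultiplication-27806), registered line
`Cruxes/MultiplicityReduction/Lines/birth.lean` («exponent ladder»).  Part of THEOREM ED
(`Theorems/GraphEquationsExponentDescent.lean` proves its middle stub `stub_exponentDescent` by
statement); paper lens-5 g94, Lean text g95–g101, first elaborated g122.

* S2 (steps 5–12)  `jet_count` (abstract: `τ_i ∈ 𝔪 ⊂ ℂ[u_σ]` with linear parts killing a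
  subspace `K` of dimension `s`, `C γ · 𝔪^M ⊆ (τ) + 𝔪^(M+1)`-type containment ⇒
  `s (s + M − 1) ≤ M (M − 1) · #τ`), with the library lemmas `exists_dual_family`,
  `exists_isHomogeneous_lift`, `finrank_homogeneousSubmodule_fin`;
* `EqSystem.jetCount`: for `E` correct, `x ∈ W_n`, `g(x) ≠ 0`, `g · 𝕀(W_n)^M ⊆ (tests)`, `M ≥ 2`:
  `corank · (corank + M − 1) ≤ M (M − 1) · cost`.
-/

set_option linter.dupNamespace false

namespace Summit.MatrixMultiplication.MatrixMultiplication.Theorems.GraphEquations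

open MvPolynomial
-- `Basis` below is `Module.Basis` (tree precedent `open Matrix Module`,
-- GraphEquationsCorankUnmasking l.49).
open Module
open Literature.Computability.AlgebraicComplexity
open Literature.Computability.AlgebraicComplexity.ArithCircuit
open Literature.AlgebraicGeometry.Hironaka2017.EdgeAlgebra (isHomogeneous_aeval_linear
  homogeneousComponent_aeval_linear)
open Literature.AlgebraicGeometry.Resolution (homogeneousComponent_eq_zero_of_mem_pow_idealOfVars
  mem_pow_idealOfVars_of_isHomogeneous sub_sum_homogeneousComponent_mem_pow_idealOfVars)

variable {n : ℕ}

/-! ## S2, steps 5–12: the abstract jet count -/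

section JetCount

variable {σ : Type} [Fintype σ] [DecidableEq σ]

omit [Fintype σ] in
/-- (F1) `[γ φ]_N = γ(0) · φ` for `φ` homogeneous of degree `N`: the part `(γ − γ(0)) φ` lies in
`𝔪^{N+1}` (L2). -/
theorem homogeneousComponent_mul_of_isHomogeneous_right (γ : MvPolynomial σ ℂ) {φ : MvPolynomial σ ℂ}
    {N : ℕ} (hφ : φ.IsHomogeneous N) :
    homogeneousComponent N (γ * φ) = C (coeff 0 γ) * φ := by
  have hsplit : γ * φ = C (coeff 0 γ) * φ + (γ - C (coeff 0 γ)) * φ := by ring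
  have hγ1 : γ - C (coeff 0 γ) ∈ MvPolynomial.idealOfVars σ ℂ := by
    -- `𝔪 = 𝔪^1`, criterion `mem_pow_idealOfVars_iff'` (Mathlib MvPolynomial/Ideal.lean l.110):
    -- the only monomial of degree `< 1` is `0`, and `coeff 0 (γ − C γ₀) = 0`.
    rw [← pow_one (MvPolynomial.idealOfVars σ ℂ), MvPolynomial.mem_pow_idealOfVars_iff']
    intro d hd
    have hd0 : d = 0 := by simpa [Nat.lt_one_iff, Finsupp.degree_eq_zero_iff] using hd
    subst hd0
    simp
  have hhigh : (γ - C (coeff 0 γ)) * φ ∈ MvPolynomial.idealOfVars σ ℂ ^ (N + 1) := by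
    rw [pow_succ']
    exact Ideal.mul_mem_mul hγ1 (mem_pow_idealOfVars_of_isHomogeneous hφ)
  rw [hsplit, map_add, homogeneousComponent_C_mul, homogeneousComponent_eq_self hφ,
    homogeneousComponent_eq_zero_of_mem_pow_idealOfVars hhigh le_rfl, add_zero]

omit [Fintype σ] [DecidableEq σ] in
/-- (F2) `[h τ]_{m+2} = [h]_{m+1} · [τ]_1 + Σ_{e ≤ m} [h]_e · [τ]_{m+2−e}` for `τ ∈ 𝔪`
(`h = Σ_{e ≤ m+1} [h]_e + (𝔪^{m+2})`, (H1) termwise, L2 on the remainder). -/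
theorem homogeneousComponent_mul_of_coeff_zero_eq_zero (h τ : MvPolynomial σ ℂ)
    (hτ : coeff 0 τ = 0) (m : ℕ) :
    homogeneousComponent (m + 2) (h * τ) =
      homogeneousComponent (m + 1) h * homogeneousComponent 1 τ +
        ∑ e ∈ Finset.range (m + 1), homogeneousComponent e h * homogeneousComponent (m + 2 - e) τ := by
  have hτm : τ ∈ MvPolynomial.idealOfVars σ ℂ := by
    rw [← pow_one (MvPolynomial.idealOfVars σ ℂ), MvPolynomial.mem_pow_idealOfVars_iff']
    intro d hd
    have hd0 : d = 0 := by simpa [Nat.lt_one_iff, Finsupp.degree_eq_zero_iff] using hd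
    subst hd0
    exact hτ
  -- `h = Σ_{e < m+2} [h]_e + h'`, `h' ∈ 𝔪^{m+2}` (Literature Resolution l.124)
  have hrem := sub_sum_homogeneousComponent_mem_pow_idealOfVars h (m + 1)
  set h' := h - ∑ i ∈ Finset.range (m + 1 + 1), homogeneousComponent i h with hh'
  have hdec : h = (∑ i ∈ Finset.range (m + 2), homogeneousComponent i h) + h' := by
    rw [hh']; ring
  have hkill : homogeneousComponent (m + 2) (h' * τ) = 0 := by
    refine homogeneousComponent_eq_zero_of_mem_pow_idealOfVars (n := m + 2) ?_ le_rfl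
    rw [pow_succ]
    exact Ideal.mul_mem_mul hrem hτm
  -- termwise (H1): `[[h]_e τ]_{m+2} = [h]_e [τ]_{m+2-e}` for `e ≤ m+1`
  have hterm : ∀ e ∈ Finset.range (m + 2),
      homogeneousComponent (m + 2) (homogeneousComponent e h * τ) =
        homogeneousComponent e h * homogeneousComponent (m + 2 - e) τ := fun e he =>
    homogeneousComponent_mul_of_isHomogeneous_left
      (homogeneousComponent_isHomogeneous e h) (by simp [Finset.mem_range] at he; omega)
  conv_lhs => rw [hdec]
  rw [add_mul, map_add, hkill, add_zero, Finset.sum_mul, map_sum, Finset.sum_congr rfl hterm,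
    Finset.sum_range_succ, show m + 2 - (m + 1) = 1 from by omega]
  ring

/-- A DUAL FAMILY for a basis of a subspace `K ≤ ℂ^σ`: linear forms
`c_i = Σ_q c_i(q) u_q` with `c_i(b_k) = δ_ik`. -/
theorem exists_dual_family (K : Submodule ℂ (σ → ℂ)) {s : ℕ} (b : Basis (Fin s) ℂ K) :
    ∃ c : Fin s → σ → ℂ, ∀ i k : Fin s,
      ∑ q, c i q * ((b k : K) : σ → ℂ) q = if i = k then 1 else 0 := by
  classical
  -- Plan: extend `b.coord i : K →ₗ ℂ` to `g_i : (σ → ℂ) →ₗ ℂ` (`LinearMap.exists_extend`,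
  -- Basis/VectorSpace.lean l.287), put `c i q := g_i (fun j => if q = j then 1 else 0)`; then
  -- `Σ_q c i q * b_k q = g_i (b k)` (`LinearMap.pi_apply_eq_sum_univ`, Pi.lean l.357, and
  -- `mul_comm`/`smul_eq_mul`) `= b.coord i (b k) = (b.repr (b k)) i = δ_ik` (`Basis.repr_self`,
  -- `Finsupp.single_apply`).
  choose g hg using fun i : Fin s => LinearMap.exists_extend (b.coord i)
  refine ⟨fun i q => g i (fun j => if q = j then 1 else 0), fun i k => ?_⟩
  have hgi : g i ((b k : K) : σ → ℂ) = (b.coord i) (b k) := by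
    rw [← hg i]; rfl
  -- S2 step 5: `Σ_q c_i(q) b_k(q) = g_i(b_k) = (b.repr (b k)) i = δ_ik`.
  have hsum : ∑ q, g i (fun j => if q = j then (1 : ℂ) else 0) * ((b k : K) : σ → ℂ) q =
      g i ((b k : K) : σ → ℂ) := by
    rw [LinearMap.pi_apply_eq_sum_univ (g i)]
    exact Finset.sum_congr rfl fun q _ => by rw [smul_eq_mul, mul_comm]
  rw [hsum, hgi, Module.Basis.coord_apply, Module.Basis.repr_self, Finsupp.single_apply]
  exact if_congr eq_comm rfl rfl

/-- Forms of degree `N` in `Y` LIFT along the restriction map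
`π : u_q ↦ Σ_k b_k(q) Y_k` to forms of degree `N` in `u` (using the dual family:
`π (Σ_q c_i(q) u_q) = Y_i`, then monomial by monomial). -/
theorem exists_isHomogeneous_lift (K : Submodule ℂ (σ → ℂ)) {s : ℕ} (b : Basis (Fin s) ℂ K)
    (ψ : MvPolynomial (Fin s) ℂ) {N : ℕ} (hψ : ψ.IsHomogeneous N) :
    ∃ φ : MvPolynomial σ ℂ, φ.IsHomogeneous N ∧
      MvPolynomial.aeval (fun q : σ => ∑ k : Fin s, C (((b k : K) : σ → ℂ) q) * X k) φ = ψ := by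
  classical
  obtain ⟨c, hc⟩ := exists_dual_family K b
  -- the lifted coordinates `λ_i := Σ_q c_i(q) u_q`, `π λ_i = Y_i`:
  have hlam : ∀ i : Fin s,
      MvPolynomial.aeval (fun q : σ => ∑ k : Fin s, C (((b k : K) : σ → ℂ) q) * X k)
        (∑ q : σ, C (c i q) * X q) = (X i : MvPolynomial (Fin s) ℂ) := by
    intro i
    -- `π(Σ_q C(c_iq) u_q) = Σ_k C(Σ_q c_iq b_kq) Y_k = Σ_k C(δ_ik) Y_k = Y_i`.
    simp only [map_sum, map_mul, MvPolynomial.aeval_C, MvPolynomial.aeval_X, Finset.mul_sum,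
      MvPolynomial.algebraMap_eq]
    rw [Finset.sum_comm]
    simp_rw [← mul_assoc, ← C_mul, ← Finset.sum_mul, ← map_sum C, hc i]
    simp
  -- S2 step 6: the lift is the LINEAR SUBSTITUTION `Y_i ↦ λ_i` (graded, degree `N` kept by
  -- `isHomogeneous_aeval_linear`), and `π ∘ (Y ↦ λ) = id` on generators by `hlam`.
  have hlin : ∀ i : Fin s, (∑ q : σ, C (c i q) * X q : MvPolynomial σ ℂ).IsHomogeneous 1 :=
    fun i => IsHomogeneous.sum _ _ _ fun q _ => isHomogeneous_C_mul_X _ _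
  refine ⟨MvPolynomial.aeval (fun i : Fin s => ∑ q : σ, C (c i q) * X q) ψ,
    isHomogeneous_aeval_linear _ hlin hψ, ?_⟩
  have hcomp : (MvPolynomial.aeval (fun q : σ => ∑ k : Fin s, C (((b k : K) : σ → ℂ) q) * X k)).comp
      (MvPolynomial.aeval (fun i : Fin s => ∑ q : σ, C (c i q) * X q)) =
        AlgHom.id ℂ (MvPolynomial (Fin s) ℂ) := by
    refine MvPolynomial.algHom_ext fun i => ?_
    rw [AlgHom.comp_apply, MvPolynomial.aeval_X, AlgHom.id_apply]
    exact hlam i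
  have h := AlgHom.congr_fun hcomp ψ
  rwa [AlgHom.comp_apply, AlgHom.id_apply] at h

/-- (L7, library layer) `dim_ℂ ℂ[Y₁,…,Y_s]_e = C(s+e−1, e)` (stars and bars;
truncated subtraction makes the formula right also for `s = 0`). -/
theorem finrank_homogeneousSubmodule_fin (s e : ℕ) :
    Module.finrank ℂ (homogeneousSubmodule (Fin s) ℂ e) = (s + e - 1).choose e := by
  -- The tree already has
  -- `Literature.RingTheory.HilbertSamuel.finrank_homogeneousSubmodule_fin (k) [Field k] (t n : ℕ) :
  --    Module.finrank k (homogeneousSubmodule (Fin t) k n) = (n + t - 1).choose n`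
  -- (Literature/RingTheory/HilbertSamuel/PolynomialRing.lean l.42, `k` explicit; in the import
  -- closure: Prelims → Hironaka1970RationalNearPointCylinder → HomogeneousHilbertFunction l.2 →
  -- HilbertSamuel.PolynomialRing; used the same way at HomogeneousHilbertFunction.lean l.252).
  -- After the first rewrite the goal is `(e + s - 1).choose e = (s + e - 1).choose e`.
  rw [Literature.RingTheory.HilbertSamuel.finrank_homogeneousSubmodule_fin ℂ s e, Nat.add_comm e s]

/-- **S2 (abstract jet count).**  Let `τ_i ∈ 𝔪 ⊂ ℂ[u_σ]` (`i ∈ ι`) have linear parts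
`[τ_i]_1 = Σ_q ℓ_{iq} u_q`, let `γ(0) ≠ 0`, `M ≥ 2`, and `γ · 𝔪^M ⊆ (τ_i)_i`.  If every vector of a
subspace `K ≤ ℂ^σ` is annihilated by all the rows `ℓ_i`, then `s = dim K` satisfies
`s (s + M − 1) ≤ M (M − 1) · #ι`.
Proof: restrict to `K` along `π : u_q ↦ Σ_k b_k(q) Y_k` (a graded surjection killing every `[τ_i]_1`);
then `ℂ[Y]_M ⊆ U := Σ_i Σ_{e ≤ M−2} ℂ[Y]_e · π[τ_i]_{M−e}` and
`C(s+M−1, M) = dim ℂ[Y]_M ≤ dim U ≤ #ι · C(s+M−2, M−2)`. -/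
theorem jet_count {ι : Type} [Fintype ι] (τ : ι → MvPolynomial σ ℂ) (ℓ : ι → σ → ℂ)
    (hτ0 : ∀ i, coeff 0 (τ i) = 0)
    (hτ1 : ∀ i, homogeneousComponent 1 (τ i) = ∑ q, C (ℓ i q) * X q)
    (γ : MvPolynomial σ ℂ) (hγ : coeff 0 γ ≠ 0) {M : ℕ} (hM : 2 ≤ M)
    (hle : Ideal.span {γ} * MvPolynomial.idealOfVars σ ℂ ^ M ≤ Ideal.span (Set.range τ))
    (K : Submodule ℂ (σ → ℂ)) (hK : ∀ δ ∈ K, ∀ i, ∑ q, ℓ i q * δ q = 0) :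
    Module.finrank ℂ K * (Module.finrank ℂ K + M - 1) ≤ M * (M - 1) * Fintype.card ι := by
  classical
  obtain ⟨m, rfl⟩ : ∃ m, M = m + 2 := ⟨M - 2, by omega⟩
  set s := Module.finrank ℂ K with hs
  let b : Basis (Fin s) ℂ K := Module.finBasis ℂ K
  -- step 5: the restriction map `π` (graded: L1 and its companion `isHomogeneous_aeval_linear`)
  let lin : σ → MvPolynomial (Fin s) ℂ := fun q => ∑ k : Fin s, C (((b k : K) : σ → ℂ) q) * X k
  have hlin : ∀ q, (lin q).IsHomogeneous 1 := fun q =>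
    IsHomogeneous.sum _ _ _ fun k _ => isHomogeneous_C_mul_X _ k
  let π : MvPolynomial σ ℂ →ₐ[ℂ] MvPolynomial (Fin s) ℂ := MvPolynomial.aeval lin
  -- `π` kills the linear parts of the `τ_i` (the rows annihilate `K ∋ b_k`)
  have hπℓ : ∀ i, π (homogeneousComponent 1 (τ i)) = 0 := by
    intro i
    rw [hτ1 i]
    -- `π(Σ_q C ℓ_iq u_q) = Σ_k C(Σ_q ℓ_iq b_kq) Y_k`, and `Σ_q ℓ_iq b_kq = 0` by `hK (b k)`.
    simp only [π, lin, map_sum, map_mul, MvPolynomial.aeval_C, MvPolynomial.aeval_X, Finset.mul_sum,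
      MvPolynomial.algebraMap_eq]
    rw [Finset.sum_comm]
    simp_rw [← mul_assoc, ← C_mul, ← Finset.sum_mul, ← map_sum C]
    refine Finset.sum_eq_zero fun k _ => ?_
    rw [hK _ (b k).2 i, C_0, zero_mul]
  -- the small space `U`
  let w : ι × Fin (m + 1) → MvPolynomial (Fin s) ℂ := fun p =>
    π (homogeneousComponent (m + 2 - p.2) (τ p.1))
  let U : Submodule ℂ (MvPolynomial (Fin s) ℂ) :=
    ⨆ p : ι × Fin (m + 1), (homogeneousSubmodule (Fin s) ℂ (p.2 : ℕ)).map (LinearMap.mulRight ℂ (w p))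
  -- steps 6–10: `ℂ[Y]_{m+2} ≤ U`
  have hincl : homogeneousSubmodule (Fin s) ℂ (m + 2) ≤ U := by
    intro ψ hψ
    obtain ⟨φ, hφ, hπφ⟩ := exists_isHomogeneous_lift K b ψ hψ
    -- `γ φ ∈ γ · 𝔪^{m+2} ⊆ (τ_i)`: `γ φ = Σ_i h_i τ_i`
    have hmem : γ * φ ∈ Ideal.span (Set.range τ) :=
      hle (Ideal.mul_mem_mul (Ideal.mem_span_singleton_self γ) (mem_pow_idealOfVars_of_isHomogeneous hφ))
    obtain ⟨h, hh⟩ := Ideal.mem_span_range_iff_exists_fun.1 hmem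
    -- degree-`(m+2)` components, then `π`
    have hL : π (homogeneousComponent (m + 2) (γ * φ)) = C (coeff 0 γ) * ψ := by
      rw [homogeneousComponent_mul_of_isHomogeneous_right γ hφ, map_mul, MvPolynomial.aeval_C,
        MvPolynomial.algebraMap_eq, hπφ]
    have hR : π (homogeneousComponent (m + 2) (∑ i, h i * τ i)) ∈ U := by
      rw [map_sum, map_sum]
      refine Submodule.sum_mem _ fun i _ => ?_
      rw [homogeneousComponent_mul_of_coeff_zero_eq_zero (h i) (τ i) (hτ0 i) m, map_add, map_mul,
        hπℓ i, mul_zero, zero_add, map_sum]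
      refine Submodule.sum_mem _ fun e he => ?_
      rw [map_mul]
      have he' : e < m + 1 := Finset.mem_range.mp he
      -- the summand lies in the piece `p = (i, e)` of `U`
      refine Submodule.mem_iSup_of_mem (⟨i, ⟨e, he'⟩⟩ : ι × Fin (m + 1)) ?_
      refine Submodule.mem_map.mpr ⟨π (homogeneousComponent e (h i)), ?_, ?_⟩
      · -- `π [h_i]_e` is homogeneous of degree `e` (companion of L1)
        exact isHomogeneous_aeval_linear lin hlin (homogeneousComponent_isHomogeneous e (h i))
      · -- `LinearMap.mulRight_apply` (LinearMap/Defs.lean l.1055): `mulRight R a b = b * a`.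
        simp [w, LinearMap.mulRight_apply]
    rw [hh] at hR
    rw [hL] at hR
    -- `C γ₀ · ψ ∈ U`, `γ₀ ≠ 0` ⇒ `ψ ∈ U` — `MvPolynomial.C_mul'` (`C a * p = a • p`),
    -- `Submodule.smul_mem_iff (hγ)`.
    rw [MvPolynomial.C_mul'] at hR
    exact (Submodule.smul_mem_iff U hγ).mp hR
  -- steps 11–12: dimensions — `hdim`, then the cancellation (v).
  -- Route for `hdim`:
  --   (i)   lower end: `Module.Finite ℂ U` from `Submodule.finite_iSup`
  --         (RingTheory/Finiteness/Lattice.lean l.26) + `Module.Finite.map` (Finiteness/Basic.lean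
  --         l.276) + `Module.Finite.iff_fg.mpr (homogeneousSubmodule_fg (Fin s) ℂ e)` (Basic l.331,
  --         Homogeneous.lean l.112); then `Submodule.finrank_mono hincl`
  --         (LinearAlgebra/Dimension/Constructions.lean l.414, needs only `Module.Finite ℂ U`) and L7
  --         with `e = m + 2`: `C(s+m+1, m+2) ≤ finrank U`;
  --   (ii)  upper end WITHOUT an induction over `Finset.univ`: `Submodule.iSup_eq_range_dfinsupp_lsum`
  --         (LinearAlgebra/DFinsupp.lean l.367) writes `U` as the range of
  --         `DFinsupp.lsum ℕ (fun p => (piece p).subtype)`; `LinearMap.finrank_range_le`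
  --         (Dimension/StrongRankCondition.lean l.562), `LinearEquiv.finrank_eq
  --         DFinsupp.linearEquivFunOnFintype` (DFinsupp.lean l.145) and `Module.finrank_pi_fintype ℂ`
  --         (Constructions.lean l.297) give `finrank U ≤ Σ_p finrank (piece p)`, and
  --         `Submodule.finrank_map_le` (Constructions.lean l.409) + L7 bound each piece by
  --         `C(s+e−1, e)`, `e = p.2 ≤ m`: `finrank U ≤ card ι · Σ_{e ≤ m} C(s+e−1, e)`;
  --   (iii) `Σ_{e ≤ m} C(s+e−1, e) = C(s+m, m)`: for `s ≥ 1` this is `Nat.sum_range_add_choose m (s−1)`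
  --         (Data/Nat/Choose/Sum.lean l.147, `Σ_{i ≤ n} C(i+k, k) = C(n+k+1, k+1)`) after
  --         `Nat.choose_symm_add`; for `s = 0` both ends are `C(m+1, m+2) = 0 ≤ …` directly.
  have hdim : (s + m + 1).choose (m + 2) ≤ Fintype.card ι * (s + m).choose m := by
    -- the pieces of `U` and their finiteness
    haveI hfinS : ∀ e : ℕ, Module.Finite ℂ (homogeneousSubmodule (Fin s) ℂ e) := fun e =>
      Literature.RingTheory.MvPolynomial.finite_homogeneousSubmodule e
    let piece : ι × Fin (m + 1) → Submodule ℂ (MvPolynomial (Fin s) ℂ) := fun p =>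
      (homogeneousSubmodule (Fin s) ℂ (p.2 : ℕ)).map (LinearMap.mulRight ℂ (w p))
    have hU : U = LinearMap.range (DFinsupp.lsum ℕ fun p => (piece p).subtype) :=
      Submodule.iSup_eq_range_dfinsupp_lsum piece
    -- (iii) stars and bars, summed: `Σ_{e ≤ m} C(s+e−1, e) = C(s+m, m)` (for `s ≥ 1`)
    by_cases hs0 : s = 0
    · rw [hs0, Nat.choose_eq_zero_of_lt (by omega)]
      exact Nat.zero_le _
    have hs1 : 1 ≤ s := Nat.one_le_iff_ne_zero.mpr hs0
    have hstars : ∑ e : Fin (m + 1), (s + (e : ℕ) - 1).choose (e : ℕ) = (s + m).choose m := by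
      rw [Fin.sum_univ_eq_sum_range (fun e => (s + e - 1).choose e) (m + 1)]
      rw [Finset.sum_congr rfl fun e _ => by
        rw [show s + e - 1 = e + (s - 1) by omega, Nat.choose_symm_add]]
      rw [Nat.sum_range_add_choose m (s - 1), show m + (s - 1) + 1 = s + m by omega,
        Nat.sub_add_cancel hs1, Nat.choose_symm_add]
    -- (ii) upper end: `dim U ≤ Σ_p dim (piece p) ≤ #ι · C(s+m, m)`
    have hup : Module.finrank ℂ U ≤ Fintype.card ι * (s + m).choose m := by
      rw [hU]
      refine (LinearMap.finrank_range_le _).trans ?_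
      rw [LinearEquiv.finrank_eq DFinsupp.linearEquivFunOnFintype, Module.finrank_pi_fintype]
      calc ∑ p : ι × Fin (m + 1), Module.finrank ℂ (piece p)
          ≤ ∑ p : ι × Fin (m + 1), (s + (p.2 : ℕ) - 1).choose (p.2 : ℕ) :=
            Finset.sum_le_sum fun p _ => (Submodule.finrank_map_le _ _).trans
              (finrank_homogeneousSubmodule_fin s p.2).le
        _ = Fintype.card ι * ∑ e : Fin (m + 1), (s + (e : ℕ) - 1).choose (e : ℕ) := by
            simp only [Fintype.sum_prod_type, Finset.sum_const, Finset.card_univ, smul_eq_mul]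
        _ = Fintype.card ι * (s + m).choose m := by rw [hstars]
    -- (i) lower end: `C(s+m+1, m+2) = dim ℂ[Y]_{m+2} ≤ dim U`
    haveI : Module.Finite ℂ U := by rw [hU]; infer_instance
    have hlow : (s + m + 1).choose (m + 2) ≤ Module.finrank ℂ U := by
      have h := Submodule.finrank_mono hincl
      rwa [finrank_homogeneousSubmodule_fin s (m + 2), show s + (m + 2) - 1 = s + m + 1 by omega] at h
    exact hlow.trans hup
  -- (v) cancellation `(m+2)(m+1)·C(s+m+1, m+2) = s(s+m+1)·C(s+m, m)` and `C(s+m, m) ≥ 1`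
  -- by
  -- `Nat.add_one_mul_choose_eq n k : (n + 1) * choose n k = choose (n + 1) (k + 1) * (k + 1)`
  -- (Data/Nat/Choose/Basic.lean l.131; `m + 1 + 1` and `m + 2` agree definitionally),
  -- `Nat.choose_succ_right_eq n k : choose n (k + 1) * (k + 1) = choose n k * (n - k)` (l.214),
  -- `Nat.choose_pos : k ≤ n → 0 < choose n k` (l.117), `Nat.add_sub_cancel : n + m - m = n`,
  -- `Nat.mul_le_mul_right (k) : n ≤ m → n * k ≤ m * k`, `Nat.le_of_mul_le_mul_right :
  -- a * c ≤ b * c → 0 < c → a ≤ b` (Lean core Init/Data/Nat/Basic.lean l.757 / l.774).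
  have h1 : (s + m + 1) * (s + m).choose (m + 1) = (s + m + 1).choose (m + 2) * (m + 2) :=
    Nat.add_one_mul_choose_eq (s + m) (m + 1)
  have h2 : (s + m).choose (m + 1) * (m + 1) = (s + m).choose m * s := by
    rw [Nat.choose_succ_right_eq (s + m) m, Nat.add_sub_cancel]
  have hpos : 0 < (s + m).choose m := Nat.choose_pos (Nat.le_add_left m s)
  have key : s * (s + m + 1) * (s + m).choose m ≤
      (m + 2) * (m + 1) * Fintype.card ι * (s + m).choose m :=
    calc s * (s + m + 1) * (s + m).choose m
        = (s + m + 1) * ((s + m).choose (m + 1) * (m + 1)) := by rw [h2]; ring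
      _ = (s + m + 1).choose (m + 2) * (m + 2) * (m + 1) := by rw [← mul_assoc, h1]
      _ ≤ Fintype.card ι * (s + m).choose m * (m + 2) * (m + 1) :=
          Nat.mul_le_mul_right _ (Nat.mul_le_mul_right _ hdim)
      _ = (m + 2) * (m + 1) * Fintype.card ι * (s + m).choose m := by ring
  have hfin : s * (s + m + 1) ≤ (m + 2) * (m + 1) * Fintype.card ι :=
    Nat.le_of_mul_le_mul_right key hpos
  -- the goal `s * (s + (m + 2) - 1) ≤ (m + 2) * (m + 2 - 1) * Fintype.card ι` has two truncated
  -- subtractions; normalise them and close.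
  have e1 : s + (m + 2) - 1 = s + m + 1 := by omega
  have e2 : m + 2 - 1 = m + 1 := by omega
  rw [e1, e2]
  exact hfin

end JetCount

/-! ## S2: the jet count for an equation system (THEOREM ED (a)) -/

namespace EqSystem

/-- **S2 (THEOREM ED (a)).**  `E` correct, `x ∈ W_n`, `g(x) ≠ 0`, `g · 𝕀(W_n)^M ⊆ (tests of E)`,
`M ≥ 2`: the corank `s` of `J_C(E)(x)` satisfies `s (s + M − 1) ≤ M (M − 1) · cost E`.
(Applied to `E.trim`: same test ideal, same kernel (L6), `#tests ≤ cost`.) -/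
theorem jetCount {E : EqSystem n} (hE : E.Correct) {x : GraphVars n → ℂ} (hx : x ∈ mmGraph n)
    {g : MvPolynomial (GraphVars n) ℂ} (hgx : MvPolynomial.eval x g ≠ 0) {M : ℕ} (hM : 2 ≤ M)
    (hle : Ideal.span {g} * MvPolynomial.vanishingIdeal ℂ (mmGraph n) ^ M ≤
      Ideal.span {p | ∃ j ∈ E.tests, p = E.testPoly j}) :
    E.corank x * (E.corank x + M - 1) ≤ M * (M - 1) * E.cost := by
  classical
  have hEt : E.trim.Correct := trim_correct hE
  -- the data of the abstract count, for `E.trim`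
  let L := E.trim.tests.length
  let τ : Fin L → MvPolynomial (Fin n × Fin n) ℂ := fun s =>
    fibreJet x (E.trim.testPoly (E.trim.tests.get s))
  let ℓ : Fin L → (Fin n × Fin n) → ℂ := fun s q => E.trim.jacobianC x s q
  have hτ0 : ∀ s, coeff 0 (τ s) = 0 := fun s => by
    show coeff 0 (fibreJet x (E.trim.testPoly (E.trim.tests.get s))) = 0
    rw [coeff_zero_fibreJet]
    exact hEt.eval_testPoly_eq_zero hx (List.get_mem _ _)
  have hτ1 : ∀ s, homogeneousComponent 1 (τ s) = ∑ q, C (ℓ s q) * X q := fun s =>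
    homogeneousComponent_one_fibreJet hx (hEt.testPoly_mem_graphIdeal' (List.get_mem _ _))
  have hγ : coeff 0 (fibreJet x g) ≠ 0 := by
    rwa [coeff_zero_fibreJet]
  -- transport of the hypothesis along `Φ_x` (steps 2–3; E-b `tests_set_eq_range`, ExponentOne l.52)
  have hle' : Ideal.span {fibreJet x g} * MvPolynomial.idealOfVars (Fin n × Fin n) ℂ ^ M ≤
      Ideal.span (Set.range τ) := by
    have h1 := Ideal.map_mono (f := fibreJet x) hle
    rw [Ideal.map_mul, map_fibreJet_vanishingIdeal_pow hx, Ideal.map_span, Set.image_singleton,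
      ← span_tests_trim, tests_set_eq_range, Ideal.map_span, ← Set.range_comp] at h1
    exact h1
  have hK : ∀ δ ∈ LinearMap.ker (E.trim.jacobianC x).mulVecLin, ∀ s, ∑ q, ℓ s q * δ q = 0 := by
    intro δ hδ s
    have h := congr_fun (LinearMap.mem_ker.mp hδ) s
    simpa [Matrix.mulVecLin_apply, Matrix.mulVec, dotProduct] using h
  have hcount := jet_count τ ℓ hτ0 hτ1 (fibreJet x g) hγ hM hle' _ hK
  rw [ker_jacobianC_trim E x, ← corank_eq_finrank_ker E x, Fintype.card_fin] at hcount
  calc E.corank x * (E.corank x + M - 1) ≤ M * (M - 1) * E.trim.tests.length := hcount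
    _ ≤ M * (M - 1) * E.cost := Nat.mul_le_mul_left _ (trim_tests_length_le E)

end EqSystem
end Summit.MatrixMultiplication.MatrixMultiplication.Theorems.GraphEquations
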